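import Summits.KontsevichZagierPeriods.KontsevichZagierPeriods.Theses.SpectrahedralScissors
import Literature.NumberTheory.Transcendental.KZBallPeeling
import Literature.NumberTheory.Transcendental.KZRelationsLE
import Literature.NumberTheory.Transcendental.KZLogCalculusProofs

/-!
# Birth skeleton (BC3) for crux `QubitCore833` — route `SpectrahedralScissors`

Crux (route decl, fixed): `[Core, 33] ~ [K, 8]` in the KZ calculus, where on the chart `ℝ¹²`
`ρ(x) = [[X, Z], [Zᴴ, ½·1 − X]]`, `K = {ρ ≽ 0}` (12-dim spectrahedron: two-qubit states with
maximally mixed second marginal) and `Core = K ∩ {½·1 − ρ ≽ 0}` (its central-symmetry core = the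
PPT = separable states of the fibre). Values (theorems of the tree,
`ZhangJiangXie2025.volume_Kset_value`, `volume_K'set_value`): `vol K = π⁵/1238630400`,
`vol Core = π⁵/5109350400`, so `33·vol Core = 8·vol K = π⁵/154828800`.

Line (plan (A) of the route header, Lovas–Andai fibration at `D = ½`, made into four named
lemmas): both pinned representations are normalised, inside the rules, to the SAME canonical
representation `[B₁₀, 1/1290240]` of `π⁵/154828800` (`B₁₀` the open unit ball of `ℝ¹⁰`,
`vol B₁₀ = π⁵/120`, `154828800 = 120 · 1290240`), each in two steps:

* `stub_schurK` / `stub_schurCore` — SCHUR SECTION (one change of variables, rule 2, plus the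
  null set `{det X · det(½−X) = 0}` by rule 1a): `Z = X^{1/2} C (½−X)^{1/2}` over the open body
  `0 ≺ X ≺ ½·1` has real Jacobian `det(X)² det(½−X)²` on `ℂ^{2×2} ≅ ℝ⁸`; the fibre of `K` is the
  operator-norm ball `{1 − CᴴC ≽ 0}` and the fibre of `Core` is
  `{1 − CᴴC ≽ 0} ∩ {W² − CᴴW²C ≽ 0}`, `W² = X(½−X)⁻¹` (Schur complements of `ρ` and of `½·1 − ρ`,
  congruence by `(½−X)^{±1/2}`; `X` and `½ − X` commute). Output: the pinned 12-dim
  representations `[S_K, 8·det(X)²det(½−X)²]`, `[S_Core, 33·det(X)²det(½−X)²]`.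
* `stub_ballK` — `[S_K, 8·det(X)²det(½−X)²] ~ [B₁₀, 1/1290240]`: unitary diagonalisation cells of
  `X` (orbit factor `π`, Vandermonde `(μ₁−μ₂)²`), the complex matrix-variate Beta integral
  `∫_{0≺X≺½} det² det² = π/103219200`, the operator ball `vol₈ = π⁴/12`, and the ball/Beta
  technology of `KZBallVolume.lean` (`k!·⟦B_{2k}⟧ = ⟦β(½,½)⟧^k`).
* `stub_ballCore` — `[S_Core, 33·det(X)²det(½−X)²] ~ [B₁₀, 1/1290240]`: the HARD stub — in the
  eigen-chart of `X` the fibre is `B ∩ V_ε B V_ε⁻¹`, `ε² = μ₂(½−μ₁)/(μ₁(½−μ₂))`, so this is the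
  route's `DefectPoly` (Slater's `χ̃₂(ε) = ε²(4−ε²)/3`, value proved in the tree:
  `ZhangJiangXie2025.volume_Ebody_eq`) applied FIBREWISE with `ε` an algebraic function of the
  base, followed by the residual polynomial identity in `(μ₁, μ₂)` (integrand
  `(μ₁−μ₂)² B³(4A−B)`, `A = μ₁(½−μ₂)`, `B = μ₂(½−μ₁)`) and the same `π⁵` normalisation.

`equivalent_of_stubs` (sorry-free glue, standard axioms only): existence of the canonical ball
representation (`KZ.BallPeeling.exists_ballRep`, `IntegralRep.constMul`), then
`r ~ s_Core ~ b ~ s_K ~ r'` by symmetry/transitivity of `KZ.Equivalent`;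
`QubitCore833_of : QubitCore833` concludes the crux BY NAME from the four stubs BY NAME
(tree convention for registered skeletons, `#h21_check_skeleton`): `sorry` occurs only in `stub_*`.
-/

noncomputable section

namespace Summit.KontsevichZagierPeriods.KontsevichZagierPeriods.Cruxes.QubitCore833.Birth

open Set
open scoped ComplexOrder Matrix BigOperators
open Literature.NumberTheory.Transcendental
open Summit.KontsevichZagierPeriods.KontsevichZagierPeriods.Theses.SpectrahedralScissors (QubitCore833)

/-- **Stub 1 (Schur section of `K`, size M).** For the crux's chart `ρ` and any representation
pinned as `[K, 8]`, there is a representation pinned as `[S_K, 8·det(X)²det(½−X)²]`,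
`S_K = {0 ≺ X ≺ ½·1} × {1 − CᴴC ≽ 0} ⊆ ℝ⁴ × ℝ⁸`, equivalent to it (one change of variables
`Z = X^{1/2} C (½−X)^{1/2}` + the null set of singular `X`, `½ − X`). -/
theorem stub_schurK :
    ∀ (ρ : (Fin 12 → ℝ) → Matrix (Fin 4) (Fin 4) ℂ), (∀ x, ρ x = !![((x 0 : ℝ) : ℂ), (⟨x 2, x 3⟩ : ℂ), (⟨x 4, x 5⟩ : ℂ), (⟨x 6, x 7⟩ : ℂ); (⟨x 2, -x 3⟩ : ℂ), ((x 1 : ℝ) : ℂ), (⟨x 8, x 9⟩ : ℂ), (⟨x 10, x 11⟩ : ℂ); (⟨x 4, -x 5⟩ : ℂ), (⟨x 8, -x 9⟩ : ℂ), ((1 / 2 - x 0 : ℝ) : ℂ), (⟨-x 2, -x 3⟩ : ℂ); (⟨x 6, -x 7⟩ : ℂ), (⟨x 10, -x 11⟩ : ℂ), (⟨-x 2, x 3⟩ : ℂ), ((1 / 2 - x 1 : ℝ) : ℂ)]) →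
    ∀ (X C : (Fin 12 → ℝ) → Matrix (Fin 2) (Fin 2) ℂ),
      (∀ w, X w = !![((w 0 : ℝ) : ℂ), (⟨w 2, w 3⟩ : ℂ); (⟨w 2, -w 3⟩ : ℂ), ((w 1 : ℝ) : ℂ)]) →
      (∀ w, C w = !![(⟨w 4, w 5⟩ : ℂ), (⟨w 6, w 7⟩ : ℂ); (⟨w 8, w 9⟩ : ℂ), (⟨w 10, w 11⟩ : ℂ)]) →
    ∀ (r' : KZ.IntegralRep 12), r'.domain = {x | (ρ x).PosSemidef} →
      EqOn r'.integrand (fun _ => 8) r'.domain →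
    ∃ s : KZ.IntegralRep 12,
      s.domain = {w | (X w).PosDef ∧ ((2 : ℂ)⁻¹ • (1 : Matrix (Fin 2) (Fin 2) ℂ) - X w).PosDef ∧
        ((1 : Matrix (Fin 2) (Fin 2) ℂ) - (C w)ᴴ * C w).PosSemidef} ∧
      EqOn s.integrand (fun w => 8 * ((w 0 * w 1 - w 2 ^ 2 - w 3 ^ 2) ^ 2 *
        ((1 / 2 - w 0) * (1 / 2 - w 1) - w 2 ^ 2 - w 3 ^ 2) ^ 2)) s.domain ∧
      KZ.Equivalent r' s := by sorry

/-- **Stub 2 (`K`-side normalisation to `π⁵`, size L).** Every representation pinned as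
`[S_K, 8·det(X)²det(½−X)²]` is equivalent to the canonical `[B₁₀, 1/1290240]`
(value `8·vol K = π⁵/154828800 = vol(B₁₀)/1290240`): diagonalisation cells of `X`, the complex
matrix Beta integral `∫_{0≺X≺½} det(X)²det(½−X)² dX = π/103219200`, `vol₈{1 − CᴴC ≽ 0} = π⁴/12`,
and `5!·⟦B₁₀⟧ = ⟦β(½,½)⟧⁵` (`KZBallVolume`). -/
theorem stub_ballK :
    ∀ (X C : (Fin 12 → ℝ) → Matrix (Fin 2) (Fin 2) ℂ),
      (∀ w, X w = !![((w 0 : ℝ) : ℂ), (⟨w 2, w 3⟩ : ℂ); (⟨w 2, -w 3⟩ : ℂ), ((w 1 : ℝ) : ℂ)]) →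
      (∀ w, C w = !![(⟨w 4, w 5⟩ : ℂ), (⟨w 6, w 7⟩ : ℂ); (⟨w 8, w 9⟩ : ℂ), (⟨w 10, w 11⟩ : ℂ)]) →
    ∀ (s : KZ.IntegralRep 12),
      s.domain = {w | (X w).PosDef ∧ ((2 : ℂ)⁻¹ • (1 : Matrix (Fin 2) (Fin 2) ℂ) - X w).PosDef ∧
        ((1 : Matrix (Fin 2) (Fin 2) ℂ) - (C w)ᴴ * C w).PosSemidef} →
      EqOn s.integrand (fun w => 8 * ((w 0 * w 1 - w 2 ^ 2 - w 3 ^ 2) ^ 2 *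
        ((1 / 2 - w 0) * (1 / 2 - w 1) - w 2 ^ 2 - w 3 ^ 2) ^ 2)) s.domain →
    ∀ (b : KZ.IntegralRep 10), b.domain = {z | ∑ i, (z i) ^ 2 < 1} →
      EqOn b.integrand (fun _ => (1290240 : ℝ)⁻¹) b.domain →
    KZ.Equivalent s b := by sorry

/-- **Stub 3 (Schur section of `Core`, size M).** For the crux's chart `ρ` and any
representation pinned as `[Core, 33]`, there is a representation pinned as
`[S_Core, 33·det(X)²det(½−X)²]`, `S_Core = S_K ∩ {W² − CᴴW²C ≽ 0}`, `W² = X(½·1 − X)⁻¹`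
(Schur complement of `½·1 − ρ = [[½−X, −Z], [−Zᴴ, X]]` after the same change of variables;
in the eigenbasis of `X` this fibre is Lovas–Andai's `B ∩ V_ε B V_ε⁻¹`), equivalent to it. -/
theorem stub_schurCore :
    ∀ (ρ : (Fin 12 → ℝ) → Matrix (Fin 4) (Fin 4) ℂ), (∀ x, ρ x = !![((x 0 : ℝ) : ℂ), (⟨x 2, x 3⟩ : ℂ), (⟨x 4, x 5⟩ : ℂ), (⟨x 6, x 7⟩ : ℂ); (⟨x 2, -x 3⟩ : ℂ), ((x 1 : ℝ) : ℂ), (⟨x 8, x 9⟩ : ℂ), (⟨x 10, x 11⟩ : ℂ); (⟨x 4, -x 5⟩ : ℂ), (⟨x 8, -x 9⟩ : ℂ), ((1 / 2 - x 0 : ℝ) : ℂ), (⟨-x 2, -x 3⟩ : ℂ); (⟨x 6, -x 7⟩ : ℂ), (⟨x 10, -x 11⟩ : ℂ), (⟨-x 2, x 3⟩ : ℂ), ((1 / 2 - x 1 : ℝ) : ℂ)]) →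
    ∀ (X C : (Fin 12 → ℝ) → Matrix (Fin 2) (Fin 2) ℂ),
      (∀ w, X w = !![((w 0 : ℝ) : ℂ), (⟨w 2, w 3⟩ : ℂ); (⟨w 2, -w 3⟩ : ℂ), ((w 1 : ℝ) : ℂ)]) →
      (∀ w, C w = !![(⟨w 4, w 5⟩ : ℂ), (⟨w 6, w 7⟩ : ℂ); (⟨w 8, w 9⟩ : ℂ), (⟨w 10, w 11⟩ : ℂ)]) →
    ∀ (r : KZ.IntegralRep 12),
      r.domain = {x | (ρ x).PosSemidef ∧
        ((2 : ℂ)⁻¹ • (1 : Matrix (Fin 4) (Fin 4) ℂ) - ρ x).PosSemidef} →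
      EqOn r.integrand (fun _ => 33) r.domain →
    ∃ s : KZ.IntegralRep 12,
      s.domain = {w | (X w).PosDef ∧ ((2 : ℂ)⁻¹ • (1 : Matrix (Fin 2) (Fin 2) ℂ) - X w).PosDef ∧
        ((1 : Matrix (Fin 2) (Fin 2) ℂ) - (C w)ᴴ * C w).PosSemidef ∧
        (X w * ((2 : ℂ)⁻¹ • (1 : Matrix (Fin 2) (Fin 2) ℂ) - X w)⁻¹ -
          (C w)ᴴ * (X w * ((2 : ℂ)⁻¹ • (1 : Matrix (Fin 2) (Fin 2) ℂ) - X w)⁻¹) * C w).PosSemidef} ∧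
      EqOn s.integrand (fun w => 33 * ((w 0 * w 1 - w 2 ^ 2 - w 3 ^ 2) ^ 2 *
        ((1 / 2 - w 0) * (1 / 2 - w 1) - w 2 ^ 2 - w 3 ^ 2) ^ 2)) s.domain ∧
      KZ.Equivalent r s := by sorry

/-- **Stub 4 (`Core`-side normalisation to `π⁵`, size XL — the hardest stub).** Every
representation pinned as `[S_Core, 33·det(X)²det(½−X)²]` is equivalent to the canonical
`[B₁₀, 1/1290240]` (value `33·vol Core = π⁵/154828800`): diagonalisation cells of `X`, then the
route's `DefectPoly` (`[B ∩ V_εBV_ε⁻¹, 3] ~ [B, ε²(4−ε²)]`) FIBREWISE with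
`ε² = μ₂(½−μ₁)/(μ₁(½−μ₂))` an algebraic function of the base, then the residual polynomial
identity in the eigenvalues and the common `π⁵` normalisation. -/
theorem stub_ballCore :
    ∀ (X C : (Fin 12 → ℝ) → Matrix (Fin 2) (Fin 2) ℂ),
      (∀ w, X w = !![((w 0 : ℝ) : ℂ), (⟨w 2, w 3⟩ : ℂ); (⟨w 2, -w 3⟩ : ℂ), ((w 1 : ℝ) : ℂ)]) →
      (∀ w, C w = !![(⟨w 4, w 5⟩ : ℂ), (⟨w 6, w 7⟩ : ℂ); (⟨w 8, w 9⟩ : ℂ), (⟨w 10, w 11⟩ : ℂ)]) →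
    ∀ (s : KZ.IntegralRep 12),
      s.domain = {w | (X w).PosDef ∧ ((2 : ℂ)⁻¹ • (1 : Matrix (Fin 2) (Fin 2) ℂ) - X w).PosDef ∧
        ((1 : Matrix (Fin 2) (Fin 2) ℂ) - (C w)ᴴ * C w).PosSemidef ∧
        (X w * ((2 : ℂ)⁻¹ • (1 : Matrix (Fin 2) (Fin 2) ℂ) - X w)⁻¹ -
          (C w)ᴴ * (X w * ((2 : ℂ)⁻¹ • (1 : Matrix (Fin 2) (Fin 2) ℂ) - X w)⁻¹) * C w).PosSemidef} →
      EqOn s.integrand (fun w => 33 * ((w 0 * w 1 - w 2 ^ 2 - w 3 ^ 2) ^ 2 *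
        ((1 / 2 - w 0) * (1 / 2 - w 1) - w 2 ^ 2 - w 3 ^ 2) ^ 2)) s.domain →
    ∀ (b : KZ.IntegralRep 10), b.domain = {z | ∑ i, (z i) ^ 2 < 1} →
      EqOn b.integrand (fun _ => (1290240 : ℝ)⁻¹) b.domain →
    KZ.Equivalent s b := by sorry

/-- **Glue (sorry-free, axioms `propext`/`Classical.choice`/`Quot.sound`): the four stub STATEMENTS
imply the body of the crux** (the crux telescope `ρ, hρ, r, r', hd, hi, hd', hi'` opened; the conclusion
is `KZ.Equivalent r r'`, so that `QubitCore833_of` below is the only theorem concluding the crux by name).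
The canonical ball representation `[B₁₀, 1/1290240]` exists (`KZ.BallPeeling.exists_ballRep`
scaled by `IntegralRep.constMul`); then `r ~ s_Core ~ b` and `r' ~ s_K ~ b`, and
`KZ.Equivalent` is symmetric and transitive. -/
theorem equivalent_of_stubs :
    (∀ (ρ : (Fin 12 → ℝ) → Matrix (Fin 4) (Fin 4) ℂ), (∀ x, ρ x = !![((x 0 : ℝ) : ℂ), (⟨x 2, x 3⟩ : ℂ), (⟨x 4, x 5⟩ : ℂ), (⟨x 6, x 7⟩ : ℂ); (⟨x 2, -x 3⟩ : ℂ), ((x 1 : ℝ) : ℂ), (⟨x 8, x 9⟩ : ℂ), (⟨x 10, x 11⟩ : ℂ); (⟨x 4, -x 5⟩ : ℂ), (⟨x 8, -x 9⟩ : ℂ), ((1 / 2 - x 0 : ℝ) : ℂ), (⟨-x 2, -x 3⟩ : ℂ); (⟨x 6, -x 7⟩ : ℂ), (⟨x 10, -x 11⟩ : ℂ), (⟨-x 2, x 3⟩ : ℂ), ((1 / 2 - x 1 : ℝ) : ℂ)]) →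
    ∀ (X C : (Fin 12 → ℝ) → Matrix (Fin 2) (Fin 2) ℂ),
      (∀ w, X w = !![((w 0 : ℝ) : ℂ), (⟨w 2, w 3⟩ : ℂ); (⟨w 2, -w 3⟩ : ℂ), ((w 1 : ℝ) : ℂ)]) →
      (∀ w, C w = !![(⟨w 4, w 5⟩ : ℂ), (⟨w 6, w 7⟩ : ℂ); (⟨w 8, w 9⟩ : ℂ), (⟨w 10, w 11⟩ : ℂ)]) →
    ∀ (r' : KZ.IntegralRep 12), r'.domain = {x | (ρ x).PosSemidef} →
      EqOn r'.integrand (fun _ => 8) r'.domain →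
    ∃ s : KZ.IntegralRep 12,
      s.domain = {w | (X w).PosDef ∧ ((2 : ℂ)⁻¹ • (1 : Matrix (Fin 2) (Fin 2) ℂ) - X w).PosDef ∧
        ((1 : Matrix (Fin 2) (Fin 2) ℂ) - (C w)ᴴ * C w).PosSemidef} ∧
      EqOn s.integrand (fun w => 8 * ((w 0 * w 1 - w 2 ^ 2 - w 3 ^ 2) ^ 2 *
        ((1 / 2 - w 0) * (1 / 2 - w 1) - w 2 ^ 2 - w 3 ^ 2) ^ 2)) s.domain ∧
      KZ.Equivalent r' s) →
    (∀ (X C : (Fin 12 → ℝ) → Matrix (Fin 2) (Fin 2) ℂ),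
      (∀ w, X w = !![((w 0 : ℝ) : ℂ), (⟨w 2, w 3⟩ : ℂ); (⟨w 2, -w 3⟩ : ℂ), ((w 1 : ℝ) : ℂ)]) →
      (∀ w, C w = !![(⟨w 4, w 5⟩ : ℂ), (⟨w 6, w 7⟩ : ℂ); (⟨w 8, w 9⟩ : ℂ), (⟨w 10, w 11⟩ : ℂ)]) →
    ∀ (s : KZ.IntegralRep 12),
      s.domain = {w | (X w).PosDef ∧ ((2 : ℂ)⁻¹ • (1 : Matrix (Fin 2) (Fin 2) ℂ) - X w).PosDef ∧
        ((1 : Matrix (Fin 2) (Fin 2) ℂ) - (C w)ᴴ * C w).PosSemidef} →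
      EqOn s.integrand (fun w => 8 * ((w 0 * w 1 - w 2 ^ 2 - w 3 ^ 2) ^ 2 *
        ((1 / 2 - w 0) * (1 / 2 - w 1) - w 2 ^ 2 - w 3 ^ 2) ^ 2)) s.domain →
    ∀ (b : KZ.IntegralRep 10), b.domain = {z | ∑ i, (z i) ^ 2 < 1} →
      EqOn b.integrand (fun _ => (1290240 : ℝ)⁻¹) b.domain →
    KZ.Equivalent s b) →
    (∀ (ρ : (Fin 12 → ℝ) → Matrix (Fin 4) (Fin 4) ℂ), (∀ x, ρ x = !![((x 0 : ℝ) : ℂ), (⟨x 2, x 3⟩ : ℂ), (⟨x 4, x 5⟩ : ℂ), (⟨x 6, x 7⟩ : ℂ); (⟨x 2, -x 3⟩ : ℂ), ((x 1 : ℝ) : ℂ), (⟨x 8, x 9⟩ : ℂ), (⟨x 10, x 11⟩ : ℂ); (⟨x 4, -x 5⟩ : ℂ), (⟨x 8, -x 9⟩ : ℂ), ((1 / 2 - x 0 : ℝ) : ℂ), (⟨-x 2, -x 3⟩ : ℂ); (⟨x 6, -x 7⟩ : ℂ), (⟨x 10, -x 11⟩ : ℂ), (⟨-x 2, x 3⟩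 : ℂ), ((1 / 2 - x 1 : ℝ) : ℂ)]) →
    ∀ (X C : (Fin 12 → ℝ) → Matrix (Fin 2) (Fin 2) ℂ),
      (∀ w, X w = !![((w 0 : ℝ) : ℂ), (⟨w 2, w 3⟩ : ℂ); (⟨w 2, -w 3⟩ : ℂ), ((w 1 : ℝ) : ℂ)]) →
      (∀ w, C w = !![(⟨w 4, w 5⟩ : ℂ), (⟨w 6, w 7⟩ : ℂ); (⟨w 8, w 9⟩ : ℂ), (⟨w 10, w 11⟩ : ℂ)]) →
    ∀ (r : KZ.IntegralRep 12),
      r.domain = {x | (ρ x).PosSemidef ∧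
        ((2 : ℂ)⁻¹ • (1 : Matrix (Fin 4) (Fin 4) ℂ) - ρ x).PosSemidef} →
      EqOn r.integrand (fun _ => 33) r.domain →
    ∃ s : KZ.IntegralRep 12,
      s.domain = {w | (X w).PosDef ∧ ((2 : ℂ)⁻¹ • (1 : Matrix (Fin 2) (Fin 2) ℂ) - X w).PosDef ∧
        ((1 : Matrix (Fin 2) (Fin 2) ℂ) - (C w)ᴴ * C w).PosSemidef ∧
        (X w * ((2 : ℂ)⁻¹ • (1 : Matrix (Fin 2) (Fin 2) ℂ) - X w)⁻¹ -
          (C w)ᴴ * (X w * ((2 : ℂ)⁻¹ • (1 : Matrix (Fin 2) (Fin 2) ℂ) - X w)⁻¹) * C w).PosSemidef} ∧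
      EqOn s.integrand (fun w => 33 * ((w 0 * w 1 - w 2 ^ 2 - w 3 ^ 2) ^ 2 *
        ((1 / 2 - w 0) * (1 / 2 - w 1) - w 2 ^ 2 - w 3 ^ 2) ^ 2)) s.domain ∧
      KZ.Equivalent r s) →
    (∀ (X C : (Fin 12 → ℝ) → Matrix (Fin 2) (Fin 2) ℂ),
      (∀ w, X w = !![((w 0 : ℝ) : ℂ), (⟨w 2, w 3⟩ : ℂ); (⟨w 2, -w 3⟩ : ℂ), ((w 1 : ℝ) : ℂ)]) →
      (∀ w, C w = !![(⟨w 4, w 5⟩ : ℂ), (⟨w 6, w 7⟩ : ℂ); (⟨w 8, w 9⟩ : ℂ), (⟨w 10, w 11⟩ : ℂ)]) →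
    ∀ (s : KZ.IntegralRep 12),
      s.domain = {w | (X w).PosDef ∧ ((2 : ℂ)⁻¹ • (1 : Matrix (Fin 2) (Fin 2) ℂ) - X w).PosDef ∧
        ((1 : Matrix (Fin 2) (Fin 2) ℂ) - (C w)ᴴ * C w).PosSemidef ∧
        (X w * ((2 : ℂ)⁻¹ • (1 : Matrix (Fin 2) (Fin 2) ℂ) - X w)⁻¹ -
          (C w)ᴴ * (X w * ((2 : ℂ)⁻¹ • (1 : Matrix (Fin 2) (Fin 2) ℂ) - X w)⁻¹) * C w).PosSemidef} →
      EqOn s.integrand (fun w => 33 * ((w 0 * w 1 - w 2 ^ 2 - w 3 ^ 2) ^ 2 *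
        ((1 / 2 - w 0) * (1 / 2 - w 1) - w 2 ^ 2 - w 3 ^ 2) ^ 2)) s.domain →
    ∀ (b : KZ.IntegralRep 10), b.domain = {z | ∑ i, (z i) ^ 2 < 1} →
      EqOn b.integrand (fun _ => (1290240 : ℝ)⁻¹) b.domain →
    KZ.Equivalent s b) →
    ∀ (ρ : (Fin 12 → ℝ) → Matrix (Fin 4) (Fin 4) ℂ), (∀ x, ρ x = !![((x 0 : ℝ) : ℂ), (⟨x 2, x 3⟩ : ℂ), (⟨x 4, x 5⟩ : ℂ), (⟨x 6, x 7⟩ : ℂ); (⟨x 2, -x 3⟩ : ℂ), ((x 1 : ℝ) : ℂ), (⟨x 8, x 9⟩ : ℂ), (⟨x 10, x 11⟩ : ℂ); (⟨x 4, -x 5⟩ : ℂ), (⟨x 8, -x 9⟩ : ℂ), ((1 / 2 - x 0 : ℝ) : ℂ), (⟨-x 2, -x 3⟩ : ℂ); (⟨x 6, -x 7⟩ : ℂ), (⟨x 10, -x 11⟩ : ℂ), (⟨-x 2, x 3⟩ : ℂ), ((1 / 2 - x 1 : ℝ) : ℂ)]) →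
    ∀ (r r' : KZ.IntegralRep 12),
      r.domain = {x | (ρ x).PosSemidef ∧
        ((2 : ℂ)⁻¹ • (1 : Matrix (Fin 4) (Fin 4) ℂ) - ρ x).PosSemidef} →
      EqOn r.integrand (fun _ => 33) r.domain →
      r'.domain = {x | (ρ x).PosSemidef} → EqOn r'.integrand (fun _ => 8) r'.domain →
    KZ.Equivalent r r' := by
  intro hSchurK hBallK hSchurCore hBallCore ρ hρ r r' hd hi hd' hi'
  -- the two auxiliary charts of the Schur section (as literal lambdas; chart hypotheses by `rfl`)
  have hX : ∀ w : Fin 12 → ℝ, (fun w : Fin 12 → ℝ =>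
      (!![((w 0 : ℝ) : ℂ), (⟨w 2, w 3⟩ : ℂ); (⟨w 2, -w 3⟩ : ℂ), ((w 1 : ℝ) : ℂ)] :
        Matrix (Fin 2) (Fin 2) ℂ)) w =
      !![((w 0 : ℝ) : ℂ), (⟨w 2, w 3⟩ : ℂ); (⟨w 2, -w 3⟩ : ℂ), ((w 1 : ℝ) : ℂ)] :=
    fun w => rfl
  have hC : ∀ w : Fin 12 → ℝ, (fun w : Fin 12 → ℝ =>
      (!![(⟨w 4, w 5⟩ : ℂ), (⟨w 6, w 7⟩ : ℂ); (⟨w 8, w 9⟩ : ℂ), (⟨w 10, w 11⟩ : ℂ)] :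
        Matrix (Fin 2) (Fin 2) ℂ)) w =
      !![(⟨w 4, w 5⟩ : ℂ), (⟨w 6, w 7⟩ : ℂ); (⟨w 8, w 9⟩ : ℂ), (⟨w 10, w 11⟩ : ℂ)] :=
    fun w => rfl
  -- the canonical ball representation `[B₁₀, 1/1290240]`
  obtain ⟨b₀, hb₀d, hb₀i⟩ := KZ.BallPeeling.exists_ballRep 10 0
  have hκ : IsAlgebraic ℚ ((1290240 : ℝ)⁻¹) := by
    exact_mod_cast (isAlgebraic_nat 1290240).inv
  have hbd : (b₀.constMul ((1290240 : ℝ)⁻¹) hκ).domain = {z | ∑ i, (z i) ^ 2 < 1} := by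
    rw [KZ.IntegralRep.domain_constMul, hb₀d]
  have hbi : EqOn (b₀.constMul ((1290240 : ℝ)⁻¹) hκ).integrand (fun _ => (1290240 : ℝ)⁻¹)
      (b₀.constMul ((1290240 : ℝ)⁻¹) hκ).domain := by
    intro z _
    simp [KZ.IntegralRep.integrand_constMul, hb₀i]
  -- `r ~ s_Core ~ b`
  obtain ⟨s, hsd, hsi, hrs⟩ := hSchurCore ρ hρ _ _ hX hC r hd hi
  have hrb : KZ.Equivalent r (b₀.constMul ((1290240 : ℝ)⁻¹) hκ) :=
    hrs.trans (hBallCore _ _ hX hC s hsd hsi _ hbd hbi)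
  -- `r' ~ s_K ~ b`
  obtain ⟨s', hs'd, hs'i, hr's'⟩ := hSchurK ρ hρ _ _ hX hC r' hd' hi'
  have hr'b : KZ.Equivalent r' (b₀.constMul ((1290240 : ℝ)⁻¹) hκ) :=
    hr's'.trans (hBallK _ _ hX hC s' hs'd hs'i _ hbd hbi)
  exact hrb.trans hr'b.symm

/-- **THE SKELETON THEOREM: the crux `QubitCore833` BY NAME from the four declared stubs BY NAME**
(through the sorry-free glue `equivalent_of_stubs`; `sorry` occurs only inside the `stub_*`). -/
theorem QubitCore833_of : QubitCore833 := by
  intro ρ hρ r r' hd hi hd' hi'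
  exact equivalent_of_stubs stub_schurK stub_ballK stub_schurCore stub_ballCore ρ hρ r r' hd hi hd' hi'

end Summit.KontsevichZagierPeriods.KontsevichZagierPeriods.Cruxes.QubitCore833.Birth

end
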